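import Summits.RiemannHypothesis.RiemannHypothesis.Theorems.IntegerScrewCensusDualScrew
import Summits.RiemannHypothesis.RiemannHypothesis.Theorems.IntegerScrewCensusFastSoundB

/-!
# Route `IntegerScrew` — kernel checker for the census DUAL certificates (14): the hypotheses of a cell from the tables

From the fast trig rows at the cell's atom `j = 2000c + 1000` (`rows_err`), the log table and the light checks: the node
values of a cell satisfy `CellHyp` (`cellHyp_of_rows`) and are in range (`xy_small`); the cubic amplitude sum is below
`ampSumsW.2/2^156` (`ampC_le`); hence a cell that passes `cellCheck` with the checker's slacks has `Q_Z ≥ 0` on its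
`τ`-range (`cell_ok`).  RH-free; nothing here bears on the truth of RH.
-/

set_option linter.dupNamespace false
set_option autoImplicit false

namespace Summit.RiemannHypothesis.RiemannHypothesis.Theorems.IntegerScrew.Manifest.Fast

open Finset Complex
open Literature.Analysis.ValidatedNumerics Literature.Analysis.ValidatedNumerics.Numerics

/-! ### Table entries -/

/-- `phis` entries. -/
theorem getD_phis (logs : List FI) {n a : ℕ} (ha : a < n) : (phis logs n).getD a 0 = 16 * (logLoW logs (a + 2)).1 := by
  unfold phis
  rw [List.getD_eq_getElem _ _ (by simpa using ha)]; simp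

/-- `phis` length. -/
theorem length_phis (logs : List FI) (n : ℕ) : (phis logs n).length = n := by simp [phis]

/-- The node-value list of a cell has length `n`. -/
theorem length_vals (R : List (ℕ × List (ℕ × ℕ))) {n : ℕ} (hR : R.length = n + 2) :
    (((R.drop 2).map fun dr => dr.2.getD 0 (0, 0)).map xyOf).length = n := by
  simp [hR]

/-- Entry `a < n` of the node-value list of a cell. -/
theorem getD_vals (R : List (ℕ × List (ℕ × ℕ))) {n a : ℕ} (hR : R.length = n + 2) (ha : a < n) :
    ((((R.drop 2).map fun dr => dr.2.getD 0 (0, 0)).map xyOf).getD a (0, 0)) = xyOf ((R.getD (a + 2) (0, [])).2.getD 0 (0, 0)) := by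
  have h : a + 2 < R.length := by rw [hR]; omega
  rw [List.map_map, List.getD_eq_getElem?_getD, List.getElem?_map, List.getElem?_drop, show 2 + a = a + 2 by omega,
    List.getElem?_eq_getElem h, Option.map_some, Option.getD_some, List.getD_eq_getElem _ _ h]
  rfl

/-- The stored Gaussian integer of node `a`: `ẑ_a = 2^52 · zOf(X_a, Y_a)` with `(X_a, Y_a)` the first entry of row `a+2`. -/
theorem zh_vals (R : List (ℕ × List (ℕ × ℕ))) {n a : ℕ} (hR : R.length = n + 2) (ha : a < n) :
    zh (((R.drop 2).map fun dr => dr.2.getD 0 (0, 0)).map xyOf) a =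
      ((SCL : ℕ) : ℂ) * zOf ((R.getD (a + 2) (0, [])).2.getD 0 (0, 0)).1 ((R.getD (a + 2) (0, [])).2.getD 0 (0, 0)).2 := by
  unfold zh
  rw [getD_vals R hR ha]
  have hS : (SCL : ℝ) ≠ 0 := by norm_num [SCL]
  apply Complex.ext
  · simp [xyOf, zOf, Complex.mul_re]; field_simp
  · simp [xyOf, zOf, Complex.mul_im]; field_simp

/-- **The node values of a cell are in range**: `|x_a|, |y_a| ≤ 2^53`. -/
theorem xy_small {n c Wm : ℕ} {logs : List FI} (hWm : Wm = maxLogWidth logs (n + 1))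
    (hlogs : ∀ m, 2 ≤ m → m ≤ n + 1 → FI.mem (Real.log m) (logs.getD m (FI.ofInt 0)))
    (h26 : (32 * (2000 * c + 1000) * Wm + 7000) * 26 ≤ SCL * 500) (hflag : (rows tcList logs 500 [2000 * c + 1000] n).2 = true) :
    ∀ a, |(((((rows tcList logs 500 [2000 * c + 1000] n).1.drop 2).map fun dr => dr.2.getD 0 (0, 0)).map xyOf).getD a (0, 0)).1| ≤ 2 ^ 53 ∧
      |(((((rows tcList logs 500 [2000 * c + 1000] n).1.drop 2).map fun dr => dr.2.getD 0 (0, 0)).map xyOf).getD a (0, 0)).2| ≤ 2 ^ 53 := by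
  intro a
  set R := (rows tcList logs 500 [2000 * c + 1000] n).1 with hRdef
  have hR : R.length = n + 2 := rows_length _ _ _ _ _
  by_cases ha : a < n
  · rw [getD_vals R hR ha]
    have hU : ∀ k, k < [2000 * c + 1000].length → Uk Wm 500 ([2000 * c + 1000].getD k 0) ≤ 1 / 26 := by
      intro k hk
      simp only [List.length_singleton] at hk
      interval_cases k
      simpa using Uk_le_of_light h26
    have hrow := rows_err (logs := logs) (n := n) (Wmax := Wm) (js := [2000 * c + 1000]) (by norm_num)
      (fun m h2 hm => ⟨hlogs m h2 hm, hWm ▸ logLoW_le_maxLogWidth logs hm (by omega)⟩) hU hflag (m := a + 2) (by omega) (by omega)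
    have hsm := rowSmall_of_rowOK hrow hU
    set dr := (rows tcList logs 500 [2000 * c + 1000] n).1.getD (a + 2) (0, []) with hdr
    have hl : dr.2.length = 1 := hrow.2.2.1
    have hmem : dr.2.getD 0 (0, 0) ∈ dr.2 := by
      rw [List.getD_eq_getElem dr.2 (0, 0) (by rw [hl]; omega)]; exact List.getElem_mem _
    obtain ⟨h1, h2⟩ := hsm _ hmem
    simp only [xyOf]
    exact ⟨h1, h2⟩
  · rw [List.getD_eq_default _ _ (by rw [length_vals R hR]; omega)]
    simp

/-- **The analytic hypotheses of a cell from the tables.** -/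
theorem cellHyp_of_rows {n c Wm φmax C1N : ℕ} {logs : List FI} {Z : List (List ℤ)}
    (hWm : Wm = maxLogWidth logs (n + 1)) (hφmax : φmax = 16 * ((logLoW logs (n + 1)).1 + Wm)) (hC1N : C1N = 2 * φmax + 64)
    (hZn : Z.length = n) (hsq : ∀ row ∈ Z, row.length = Z.length)
    (hlogs : ∀ m, 2 ≤ m → m ≤ n + 1 → FI.mem (Real.log m) (logs.getD m (FI.ofInt 0)))
    (h225 : (32 * (2000 * c + 1000) * Wm + 7000) * 225 ≤ SCL * 500)
    (hφ : ∀ a, a < n → (phis logs n).getD a 0 ≤ φmax ∧ ∀ b, b < a → (phis logs n).getD b 0 ≤ (phis logs n).getD a 0)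
    (hflag : (rows tcList logs 500 [2000 * c + 1000] n).2 = true) :
    CellHyp Z (phis logs n) ((((rows tcList logs 500 [2000 * c + 1000] n).1.drop 2).map fun dr => dr.2.getD 0 (0, 0)).map xyOf)
      (fun a => Real.log ((a + 2 : ℕ) : ℝ)) (4 * (c : ℝ) + 2) (((32 * (2000 * c + 1000) * Wm + 7000 : ℕ) : ℝ) / (500 * 2 ^ 52))
      ((C1N : ℝ) / 2 ^ 52) Wm := by
  set R := (rows tcList logs 500 [2000 * c + 1000] n).1 with hRdef
  have hR : R.length = n + 2 := rows_length _ _ _ _ _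
  have h26 : (32 * (2000 * c + 1000) * Wm + 7000) * 26 ≤ SCL * 500 := le_trans (Nat.mul_le_mul_left _ (by norm_num)) h225
  have hU : ∀ k, k < [2000 * c + 1000].length → Uk Wm 500 ([2000 * c + 1000].getD k 0) ≤ 1 / 26 := by
    intro k hk
    simp only [List.length_singleton] at hk
    interval_cases k
    simpa using Uk_le_of_light h26
  have hrow : ∀ a, a < n → RowOK Wm 500 [2000 * c + 1000] (a + 2) (R.getD (a + 2) (0, [])) := fun a ha =>
    rows_err (by norm_num) (fun m h2 hm => ⟨hlogs m h2 hm, hWm ▸ logLoW_le_maxLogWidth logs hm (by omega)⟩)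
      hU hflag (by omega) (by omega)
  have hlog : ∀ a, a < n → ((logLoW logs (a + 2)).1 : ℝ) ≤ 2 ^ 48 * Real.log ((a + 2 : ℕ) : ℝ) ∧
      2 ^ 48 * Real.log ((a + 2 : ℕ) : ℝ) ≤ ((logLoW logs (a + 2)).1 : ℝ) + Wm := fun a ha => by
    obtain ⟨h1, h2⟩ := logLoW_spec (hlogs (a + 2) (by omega) (by omega))
    have hW : ((logLoW logs (a + 2)).2 : ℝ) ≤ Wm := by rw [hWm]; exact_mod_cast logLoW_le_maxLogWidth logs (by omega) (by omega)
    exact ⟨h1, by linarith⟩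
  have hn1 : ∀ a, a < n → Real.log ((a + 2 : ℕ) : ℝ) ≤ (φmax : ℝ) / 2 ^ 52 := fun a ha => by
    obtain ⟨-, h2⟩ := logLoW_spec (hlogs (n + 1) (by omega) le_rfl)
    have hW : ((logLoW logs (n + 1)).2 : ℝ) ≤ Wm := by rw [hWm]; exact_mod_cast logLoW_le_maxLogWidth logs le_rfl (by omega)
    have hmono : Real.log ((a + 2 : ℕ) : ℝ) ≤ Real.log ((n + 1 : ℕ) : ℝ) :=
      Real.log_le_log (by positivity) (by exact_mod_cast (by omega : a + 2 ≤ n + 1))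
    rw [hφmax]; push_cast at h2 hmono ⊢
    rw [le_div_iff₀ (by positivity)]
    linarith
  refine ⟨hsq, by rw [length_phis, hZn], by rw [length_vals R hR, hZn], fun a ha => ?_, div_nonneg (Nat.cast_nonneg _) (by norm_num),
    ?_, fun a ha => ?_,
    fun a ha b hb => (hφ a (hZn ▸ ha)).2 b hb, fun a ha b hb => ?_, fun a _ => Real.log_nonneg (by exact_mod_cast (by omega : 1 ≤ a + 2)),
    fun a ha => ?_, fun a ha => ?_⟩
  · -- node-value error
    rw [hZn] at ha
    rw [zh_vals R hR ha]
    have he := (hrow a ha).2.2.2 0 (by simp)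
    simp only [List.getD_cons_zero] at he
    have hd8 : ((R.getD (a + 2) (0, [])).1 : ℝ) ≤ 8 := by exact_mod_cast (hrow a ha).2.1
    have hU0 : 0 ≤ Uk Wm 500 (2000 * c + 1000) := by unfold Uk; positivity
    have h15 : (2 * ((R.getD (a + 2) (0, [])).1 : ℝ) - 1) * Uk Wm 500 (2000 * c + 1000) ≤ 15 * Uk Wm 500 (2000 * c + 1000) :=
      mul_le_mul_of_nonneg_right (by linarith) hU0
    have hUk : Uk Wm 500 (2000 * c + 1000) = (((32 * (2000 * c + 1000) * Wm + 7000 : ℕ) : ℝ) / (500 * 2 ^ 52)) := by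
      unfold Uk; push_cast; norm_num [SCL]; ring
    have hzT : zT 500 (2000 * c + 1000) (a + 2) = exp (I * (((4 * (c : ℝ) + 2) * Real.log ((a + 2 : ℕ) : ℝ) : ℝ) : ℂ)) := by
      unfold zT; rw [mul_comm _ I]; congr 2; push_cast; ring
    have hS : ((SCL : ℕ) : ℂ) = 2 ^ 52 := by norm_num [SCL]
    rw [hS, show (2 : ℂ) ^ 52 * zOf ((R.getD (a + 2) (0, [])).2.getD 0 (0, 0)).1 ((R.getD (a + 2) (0, [])).2.getD 0 (0, 0)).2 -
      2 ^ 52 * exp (I * (((4 * (c : ℝ) + 2) * Real.log ((a + 2 : ℕ) : ℝ) : ℝ) : ℂ)) = 2 ^ 52 * (zOf ((R.getD (a + 2) (0, [])).2.getD 0 (0, 0)).1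
      ((R.getD (a + 2) (0, [])).2.getD 0 (0, 0)).2 - zT 500 (2000 * c + 1000) (a + 2)) by rw [hzT]; ring, norm_mul]
    have : ‖(2 : ℂ) ^ 52‖ = 2 ^ 52 := by simp
    rw [this, ← hUk]
    exact mul_le_mul_of_nonneg_left (he.trans h15) (by norm_num)
  · -- 225 U ≤ 1
    have h : (((32 * (2000 * c + 1000) * Wm + 7000) * 225 : ℕ) : ℝ) ≤ ((SCL * 500 : ℕ) : ℝ) := by exact_mod_cast h225
    push_cast at h; norm_num [SCL] at h
    rw [← mul_div_assoc, div_le_one (by positivity)]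
    push_cast; linarith
  · -- the log-table bracket
    rw [hZn] at ha
    rw [getD_phis logs ha]
    obtain ⟨h1, h2⟩ := hlog a ha
    push_cast at h1 h2 ⊢
    constructor
    · rw [div_le_iff₀ (by positivity)]; linarith
    · rw [le_div_iff₀ (by positivity)]; linarith
  · -- ν monotone
    exact Real.log_le_log (by positivity) (by exact_mod_cast (by omega : b + 2 ≤ a + 2))
  · -- φ cap
    rw [hZn] at ha
    have := (hφ a ha).1
    rw [hC1N]; push_cast
    have h' : ((phis logs n).getD a 0 : ℝ) ≤ φmax := by exact_mod_cast this
    rw [div_le_div_iff_of_pos_right (by positivity)]; linarith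
  · -- ν cap
    rw [hZn] at ha
    have := hn1 a ha
    rw [hC1N]; push_cast at this ⊢
    rw [le_div_iff₀ (by positivity)] at this ⊢
    linarith

/-! ### The cubic amplitude sum -/

/-- **`2^156 · Σ|A_f||ν_f|³ ≤ ampSumsW.2`.** -/
theorem ampC_le {Z : List (List ℤ)} {φs : List ℕ} {xys : List (ℤ × ℤ)} {ν : ℕ → ℝ} {t0 U c1 : ℝ} {Wm : ℕ}
    (H : CellHyp Z φs xys ν t0 U c1 Wm) : 2 ^ 156 * ampC Z ν ≤ ((ampSumsW Z φs Wm).2 : ℝ) := by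
  rw [ampSumsW_snd Z φs Wm H.sq H.φlen]
  unfold ampC
  rw [Finset.mul_sum]
  refine Finset.sum_le_sum fun a ha => ?_
  rw [Finset.mem_range] at ha
  obtain ⟨hta1, hta2⟩ := H.tab a ha
  have hνa : 2 ^ 52 * |ν a| ≤ (φs.getD a 0 : ℝ) + 16 * Wm := by
    rw [abs_of_nonneg (H.ν0 a ha)]; rw [le_div_iff₀ (by positivity)] at hta2; linarith
  have hnode : 2 ^ 156 * (2 * |(sumZ (Z.getD a []) : ℝ)| * |ν a| ^ 3) ≤
      2 * |(sumZ (Z.getD a []) : ℝ)| * ((φs.getD a 0 : ℝ) + 16 * Wm) ^ 3 := by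
    have h3 : (2 ^ 52 * |ν a|) ^ 3 ≤ ((φs.getD a 0 : ℝ) + 16 * Wm) ^ 3 := pow_le_pow_left₀ (by positivity) hνa 3
    nlinarith [abs_nonneg (sumZ (Z.getD a []) : ℝ)]
  have hpair : ∀ b ∈ range a, 2 ^ 156 * (2 * |(((Z.getD a []).getD b 0 : ℤ) : ℝ)| * |ν a - ν b| ^ 3) ≤
      2 * |(((Z.getD a []).getD b 0 : ℤ) : ℝ)| * (((φs.getD a 0 - φs.getD b 0 : ℕ) : ℝ) + 16 * Wm) ^ 3 := by
    intro b hb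
    rw [Finset.mem_range] at hb
    obtain ⟨htb1, -⟩ := H.tab b (hb.trans ha)
    have hcast : ((φs.getD a 0 - φs.getD b 0 : ℕ) : ℝ) = (φs.getD a 0 : ℝ) - (φs.getD b 0 : ℝ) := by
      rw [Nat.cast_sub (H.φmono a ha b hb)]
    have hνab : 2 ^ 52 * |ν a - ν b| ≤ ((φs.getD a 0 - φs.getD b 0 : ℕ) : ℝ) + 16 * Wm := by
      rw [hcast, abs_of_nonneg (sub_nonneg.2 (H.νmono a ha b hb))]
      rw [le_div_iff₀ (by positivity)] at hta2
      rw [div_le_iff₀ (by positivity)] at htb1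
      linarith
    have h3 : (2 ^ 52 * |ν a - ν b|) ^ 3 ≤ (((φs.getD a 0 - φs.getD b 0 : ℕ) : ℝ) + 16 * Wm) ^ 3 :=
      pow_le_pow_left₀ (by positivity) hνab 3
    nlinarith [abs_nonneg (((Z.getD a []).getD b 0 : ℤ) : ℝ)]
  have hps := Finset.sum_le_sum hpair
  rw [← Finset.mul_sum] at hps
  linarith

/-! ### A cell that passes -/

/-- **A passing cell has `Q_Z ≥ 0` on its range.**  The checker's integers for the cell with atom `j = 2000c + 1000`,
the light checks and the tables give `C0 + qSum_Z(cos((4c+4τ)·)) ≥ 0` for `τ ∈ [mstart/M, mend/M]`. -/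
theorem cell_ok {D' n c fuel Wm φmax C1N mstart mend : ℕ} {logs : List FI} {Z : List (List ℤ)}
    (hWm : Wm = maxLogWidth logs (n + 1)) (hφmax : φmax = 16 * ((logLoW logs (n + 1)).1 + Wm)) (hC1N : C1N = 2 * φmax + 64)
    (hZn : Z.length = n) (hsq : ∀ row ∈ Z, row.length = Z.length) (hn : n + 1 ≤ 113)
    (hlogs : ∀ m, 2 ≤ m → m ≤ n + 1 → FI.mem (Real.log m) (logs.getD m (FI.ofInt 0)))
    (hD : 2 * C1N ≤ (D' + 1) * 2 ^ 52) (hC56 : C1N ≤ 2 ^ 56)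
    (h225 : (32 * (2000 * c + 1000) * Wm + 7000) * 225 ≤ SCL * 500)
    (hφ : ∀ a, a < n → (phis logs n).getD a 0 ≤ φmax ∧ ∀ b, b < a → (phis logs n).getD b 0 ≤ (phis logs n).getD a 0)
    (hZ62 : maxAbsZ Z ≤ 2 ^ 62) (hcap : ∀ w ∈ wDigits φmax (kConsts (D' + 1) EB) 1, w < 2 ^ 236)
    (hflag : (rows tcList logs 500 [2000 * c + 1000] n).2 = true)
    (hcell : cellCheck (D' + 1) (halfPack (D' + 1)) (nodeData (kConsts (D' + 1) EB) Z (phis logs n))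
      (constQ Z * ((K0N (D' + 1) EB : ℕ) : ℤ))
      (slacksW (D' + 1) EB (32 * (2000 * c + 1000) * Wm + 7000) C1N (ampSumsW Z (phis logs n) Wm).1 Wm)
      (lamOf (D' + 1) EB (ampSumsW Z (phis logs n) Wm).2)
      (((rows tcList logs 500 [2000 * c + 1000] n).1.drop 2).map fun dr => dr.2.getD 0 (0, 0)) mstart mend fuel = true)
    (hms : mstart < mend) (hmend : mend ≤ MR) :
    ∀ τ : ℝ, (mstart : ℝ) / MR ≤ τ → τ ≤ (mend : ℝ) / MR →
      0 ≤ (constQ Z : ℝ) + qSum Z (fun a => Real.log ((a + 2 : ℕ) : ℝ)) fun μ => Real.cos ((4 * (c : ℝ) + 4 * τ) * μ) := by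
  have H := cellHyp_of_rows (Z := Z) hWm hφmax hC1N hZn hsq hlogs h225 hφ hflag
  have h26 : (32 * (2000 * c + 1000) * Wm + 7000) * 26 ≤ SCL * 500 := le_trans (Nat.mul_le_mul_left _ (by norm_num)) h225
  have hc1 : (C1N : ℝ) / 2 ^ 52 ≤ ((D' : ℝ) + 1) / 2 := by
    rw [div_le_div_iff₀ (by positivity) (by positivity)]
    have : ((2 * C1N : ℕ) : ℝ) ≤ (((D' + 1) * 2 ^ 52 : ℕ) : ℝ) := by exact_mod_cast hD
    push_cast at this; linarith
  have hc16 : (C1N : ℝ) / 2 ^ 52 ≤ 16 := by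
    rw [div_le_iff₀ (by positivity)]
    have : (C1N : ℝ) ≤ ((2 ^ 56 : ℕ) : ℝ) := by exact_mod_cast hC56
    push_cast at this; linarith
  have hw : ∀ φ, φ ≤ φmax → ∀ k, k < D' + 1 + 1 → wAt (kConsts (D' + 1) EB) φ k < 2 ^ 236 := fun φ hφ' k hk =>
    wAt_lt_of_cap hcap hφ' (by rw [length_kConsts]; exact hk)
  have hdig : ∀ k, k < D' + 1 + 1 →
      |dRE (kConsts (D' + 1) EB) Z (phis logs n) ((((rows tcList logs 500 [2000 * c + 1000] n).1.drop 2).map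
        fun dr => dr.2.getD 0 (0, 0)).map xyOf) k| < 2 ^ (SW - 1) ∧
      |dIM (kConsts (D' + 1) EB) Z (phis logs n) ((((rows tcList logs 500 [2000 * c + 1000] n).1.drop 2).map
        fun dr => dr.2.getD 0 (0, 0)).map xyOf) k| < 2 ^ (SW - 1) := fun k hk =>
    digits_lt (E := EB) Z (phis logs n) _ (φmax := φmax) (by rw [hZn]; omega) hsq hZ62 hw
      (fun a ha => (hφ a (by rw [hZn] at ha; exact ha)).1) (xy_small hWm hlogs h26 hflag) hk
  -- the slacks
  set Un := 32 * (2000 * c + 1000) * Wm + 7000 with hUn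
  set sumA := (ampSumsW Z (phis logs n) Wm).1 with hsumA
  have hA : ampA Z = (sumA : ℝ) := by rw [hsumA, ampSumsW_fst Z (phis logs n) Wm hsq H.φlen]; rfl
  have hS0 := slacksW_S0_ge (D' + 1) EB Un C1N sumA Wm
  have hS1 := slacksW_S1_ge (D' + 1) EB Un C1N sumA Wm
  have hS2 := slacksW_S2_ge (D' + 1) EB Un C1N sumA Wm
  have hL := lamOf_ge (D' + 1) EB (ampSumsW Z (phis logs n) Wm).2
  simp only [Nat.add_sub_cancel] at hS0 hS1 hS2
  have hU : 31 * ((Un : ℕ) : ℝ) / (500 * 2 ^ 52) = 31 * (((Un : ℕ) : ℝ) / (500 * 2 ^ 52)) := by ring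
  have hMD : (0 : ℝ) ≤ (MR : ℝ) ^ (D' + 1) := pow_nonneg (Nat.cast_nonneg _) _
  have hK : (0 : ℝ) ≤ (K0N (D' + 1) EB : ℝ) := Nat.cast_nonneg _
  have hC := ampC_le H
  generalize hSdef : slacksW (D' + 1) EB Un C1N sumA Wm = S at hS0 hS1 hS2 hcell
  generalize hLdef : lamOf (D' + 1) EB (ampSumsW Z (phis logs n) Wm).2 = Lam at hL hcell
  have hD1 : (((D' + 1 : ℕ) : ℝ) + 1) = (D' : ℝ) + 2 := by push_cast; ring
  have hD2 : (((D' + 1 : ℕ) : ℝ) + 2) = (D' : ℝ) + 3 := by push_cast; ring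
  rw [hD1] at hS0 hS1
  rw [hD2] at hS2
  rw [hU] at hS0 hS1 hS2
  refine cell_sound (E := EB) H hc1 hc16 hdig ?_ ?_ ?_ ?_ hcell hms hmend
  · rw [hA]; refine le_trans (le_of_eq ?_) hS0; ring
  · rw [hA]; refine le_trans (le_of_eq ?_) hS1; ring
  · rw [hA]; refine le_trans (le_of_eq ?_) hS2; ring
  · have h1 : ampC Z (fun a => Real.log ((a + 2 : ℕ) : ℝ)) ≤ ((ampSumsW Z (phis logs n) Wm).2 : ℝ) / 2 ^ 156 := by
      rw [le_div_iff₀ (by norm_num)]; linarith [hC]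
    calc (MR : ℝ) ^ (D' + 1) * (K0N (D' + 1) EB : ℝ) * ((64 / 3) * ampC Z fun a => Real.log ((a + 2 : ℕ) : ℝ))
        = (MR : ℝ) ^ (D' + 1) * ((K0N (D' + 1) EB : ℝ) * (64 / 3) * ampC Z fun a => Real.log ((a + 2 : ℕ) : ℝ)) := by ring
      _ ≤ (MR : ℝ) ^ (D' + 1) * ((K0N (D' + 1) EB : ℝ) * (64 / 3) * (((ampSumsW Z (phis logs n) Wm).2 : ℝ) / 2 ^ 156)) :=
        mul_le_mul_of_nonneg_left (mul_le_mul_of_nonneg_left h1 (mul_nonneg hK (by norm_num))) hMD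
      _ ≤ _ := hL

end Summit.RiemannHypothesis.RiemannHypothesis.Theorems.IntegerScrew.Manifest.Fast
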